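import Literature.MathematicalPhysics.QuantumLattice.HubbardTTPrimeAnchorWordBoxTransport
import Literature.MathematicalPhysics.QuantumLattice.HubbardTTPrimeTPPFillingTransport
import HarnessLib

/-!
# Pullback of infinite-volume fermion states along an injective lattice map; the doubling map
# turns third-neighbour bonds into nearest-neighbour bonds: the kinematic row `|K₃(ω)| ≤ 16/π²` for
# every translation-invariant state, and the `t''`-transport of the certified `t–t'` energy density at
# the kinematic constant

Topic `Literature/MathematicalPhysics/QuantumLattice` (family `hubbard`; §1–§4 model-free, general `d`).
Companion of `InfVolFermionState.lean` (`shift`, the translates of a state) and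
`InfVolFermionStatePointGroupAction.lean` (`d4Act`): the same construction for an arbitrary INJECTIVE
site map `f : ℤ^d → ℤ^{d'}` — the state `ω ∘ Γ_f` seen through the sublattice `f(ℤ^d)`
(Bratteli–Robinson I §4.3.1: `ω ↦ ω ∘ α` for a `*`-morphism `α` of the quasi-local algebra; here
`α = Γ_f`, `c_{xσ} ↦ c_{f(x),σ}`, Araki–Moriya 2003 §4.1). Written for stage S2 of the Hubbard
material-oracle programme: the `t''`-boxes of the router's object-M parameter sets
(`HubbardTTPrimeTPPFillingTransport`: a `t''`-box word costs `|t''|` times a bracket on the third-neighbour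
bond density `K₃`) had only the operator-norm bracket `|K₃| ≤ 8`; the doubling map `x ↦ 2x` carries the
unit nearest-neighbour bonds onto the unit third-neighbour bonds, so `K₃(ω) = K₁(ω ∘ Γ_{2·})` and the
class-wide kinematic row `|K₁| ≤ 16/π²` (`IsTranslationInvariant.abs_meanEnergy_nnHop_le`) transfers.

* §1 `mapSet f Λ = f(Λ)`, `PolySite.mapEmb f hf Λ : Λ ↪ f(Λ)` and its second quantisation on generators.
* §2 `InfVolFermionState.mapAct f hf ω` — the pulled-back state `(ω ∘ Γ_f)_Λ(A) = ω_{f(Λ)}(Γ(mapEmb) A)`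
  (an `InfVolFermionState d`; compatibility by functoriality of `Γ`).
* §3 for ADDITIVE `f`: translation invariance transfers (`IsTranslationInvariant.mapAct`: `ω` invariant
  under `τ_{f(v)}` ⇒ `ω ∘ Γ_f` invariant under `τ_v`), and the density is preserved (`density_mapAct`).
* §4 the doubling map `x ↦ x + x` of `ℤ^d` (injective, additive; `doubling`).
* §5 (`d = 2`) THE BOND IDENTITY: the mean-energy observable of the unit nearest-neighbour hopping
  `Φ(1,0,0)` is carried by `Γ_{doubling}` onto that of the unit third-neighbour hopping `Φ''(1)`
  (`fermionEmbed_mapEmb_meanEnergyObs_nnHop`), hence `K₁(ω ∘ Γ_{2·}) = K₃(ω)`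
  (`meanEnergy_nnHop_mapAct_doubling`).
* §6 THE KINEMATIC `K₃` ROW: `|K₃(ω)| ≤ 16/π²` for every translation-invariant state of filling
  `0 < ρ < 2` (`IsTranslationInvariant.abs_meanEnergy_axialRange2Hopping_le`).
* §7 `t''`-TRANSPORT AT THE KINEMATIC CONSTANT: for `U ≥ 0`, `0 < ρ < 2` and every `t''`,
  `|e_ρ(t,t',t'',U) − energyDensityTT' t t' U ρ| ≤ (16/π²)|t''|`
  (`abs_tiGroundEnergyDensityAt_tpp_sub_energyDensityTT'_le_kinematic`; `16/π² < 1.6212`: a `t''/t = 0.1`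
  truncation moves the certified fixed-filling density by at most `0.163 t`, vs `0.8 t` from the norm).

Everything is PROVED; the three definitions (`mapSet`, `PolySite.mapEmb`, `InfVolFermionState.mapAct`,
plus the abbreviation `doubling`) have bodies; no named fact, no number of record, no `sorry`.
HONEST SCOPE: kinematic (one-body, density-blind within `(0,2)`) constant only; certified `K₃` words
at the anchor remain the way to usable `t''`-box losses; nothing bears on order / pairing words.

## Mathlib / tree search

Tree (REUSED): `fermionEmbed`, `fermionEmbed_fermionEmbed`, `fermionEmbed_congr`, `fermionEmbed_annihilation`,
`fermionEmbed_conjTranspose`, `PolySite.pt/incl/shiftEmb`, `shift_expect`, `mem_shiftSet`, `mem_box`, `thicken`,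
`hubbardTTPrimeFermionInteraction_meanEnergyObs`, `hubbardFermionInteraction_meanEnergyObs`,
`hubbardFermionInteraction_apply_pair/_singleton`, `diagHoppingFermionInteraction_smul`,
`FermionInteraction.meanEnergyObs_of_smul`, `axialRange2HoppingFermionInteraction_meanEnergyObs/_apply_pair`,
`axial2Vec_eq_unitVec_add_unitVec`, `IsTranslationInvariant.abs_meanEnergy_nnHop_le`
(`HubbardTTPrimeAnchorWordBoxTransport`), `energyDensityTT'_floor_add_min_le_tpp`, `tpp_le_cap_add_max_of_one`
(`HubbardTTPrimeTPPFillingTransport`), `exists_isTorusLimitOf_meanEnergy_hubbardTTPrime_eq`.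
`lean search 'mapAct|comap.*InfVolFermionState|dilat'`: nothing (only `shift`, `d4Act`).

## References

* O. Bratteli, D. W. Robinson, *OAQSM 1* (1987), §4.3.1 (states composed with automorphisms /
  morphisms of the quasi-local algebra; invariant states). [cite: BratteliRobinsonI1987, §4.3.1]
* H. Araki, H. Moriya, Rev. Math. Phys. 15 (2003) 93, §4.1 (the local CAR algebras `𝔄(I)` and the maps
  `a_i ↦ a_{φ(i)}`). [cite: ArakiMoriya2003, §4.1]
* E. H. Lieb, M. Loss, Duke Math. J. 71 (1993) 337, §8 Thm. 8.2 (bathtub; the kinematic constant).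
  [cite: LiebLoss1993, §8, Theorem 8.2]
* E. Pavarini et al., PRL 87 (2001) 047003, eq. (1) (the `t''` term). [cite: PavariniEtAl2001, eq. (1)]
-/

noncomputable section

namespace Literature.MathematicalPhysics.QuantumLattice

open Matrix Finset HubbardWave0 Literature.Probability.LatticeModels ThermodynamicLimit
open _root_.Filter
open scoped _root_.Topology ComplexOrder BigOperators

variable {d d' : ℕ}

/-! ### §1. Regions and ordered sites under an injective lattice map -/

/-- The image region `f(Λ)`. [cite: ArakiMoriya2003, §4.1] -/
def mapSet (f : Site d → Site d') (Λ : Finset (Site d)) : Finset (Site d') := Λ.image f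

/-- `f x ∈ f(Λ)` for `x ∈ Λ`. [cite: ArakiMoriya2003, §4.1] -/
theorem mem_mapSet_of_mem (f : Site d → Site d') {Λ : Finset (Site d)} {x : Site d} (hx : x ∈ Λ) :
    f x ∈ mapSet f Λ :=
  mem_image_of_mem f hx

/-- Membership in the image region. [cite: ArakiMoriya2003, §4.1] -/
theorem mem_mapSet_iff (f : Site d → Site d') {Λ : Finset (Site d)} {y : Site d'} :
    y ∈ mapSet f Λ ↔ ∃ x ∈ Λ, f x = y :=
  mem_image

/-- `mapSet` is monotone in the region. [cite: ArakiMoriya2003, §4.1] -/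
theorem mapSet_mono (f : Site d → Site d') {Λ Λ' : Finset (Site d)} (h : Λ ⊆ Λ') : mapSet f Λ ⊆ mapSet f Λ' :=
  image_subset_image h

namespace PolySite

/-- **The site map on ordered sites**: `x ↦ f x` from the sites of `Λ` to those of `f(Λ)` (injective
`f`). [cite: ArakiMoriya2003, §4.1] -/
def mapEmb (f : Site d → Site d') (hf : Function.Injective f) (Λ : Finset (Site d)) :
    PolySite Λ ↪ PolySite (mapSet f Λ) :=
  ⟨fun y => pt (f (ofLex y.1)) (mem_mapSet_of_mem f (ofLex_mem y)),
    fun y y' hy => by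
      have h : f (ofLex y.1) = f (ofLex y'.1) :=
        congrArg (fun z : PolySite (mapSet f Λ) => ofLex z.1) hy
      exact Subtype.ext (congrArg toLex (hf h))⟩

/-- `mapEmb` on a site. [cite: ArakiMoriya2003, §4.1] -/
@[simp] theorem mapEmb_pt (f : Site d → Site d') (hf : Function.Injective f) {Λ : Finset (Site d)}
    (x : Site d) (hx : x ∈ Λ) : mapEmb f hf Λ (pt x hx) = pt (f x) (mem_mapSet_of_mem f hx) := rfl

/-- The underlying site of a mapped ordered site. [cite: ArakiMoriya2003, §4.1] -/
@[simp] theorem ofLex_coe_mapEmb (f : Site d → Site d') (hf : Function.Injective f) {Λ : Finset (Site d)}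
    (y : PolySite Λ) : ofLex (mapEmb f hf Λ y).1 = f (ofLex y.1) := rfl

/-- Underlying ordered site of a mapped site (the `coe` normal form used in `fermionEmbed_congr` proofs).
[cite: ArakiMoriya2003, §4.1] -/
@[simp] theorem coe_mapEmb_eq (f : Site d → Site d') (hf : Function.Injective f) {Λ : Finset (Site d)}
    (y : PolySite Λ) : (mapEmb f hf Λ y).1 = toLex (f (ofLex y.1)) := rfl

/-- `pt` only depends on the site. [cite: ArakiMoriya2003, §4.1] -/
theorem pt_congr {Λ : Finset (Site d)} {x y : Site d} (hx : x ∈ Λ) (hy : y ∈ Λ) (h : x = y) :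
    pt x hx = pt y hy := by
  subst h
  rfl

end PolySite

/-- **`Γ_f` on generators**: `Γ(mapEmb) c_{xσ} = c_{f x, σ}`. [cite: ArakiMoriya2003, §4.1] -/
theorem fermionEmbed_mapEmb_cAt (f : Site d → Site d') (hf : Function.Injective f) {Λ : Finset (Site d)}
    (x : Site d) (hx : x ∈ Λ) (σ : Fin 2) :
    fermionEmbed (PolySite.mapEmb f hf Λ) (cAt x hx σ) = cAt (f x) (mem_mapSet_of_mem f hx) σ :=
  fermionEmbed_annihilation _ _ _

/-- `Γ(φ) c_{xσ} = c_{yσ}` whenever `φ` sends the ordered site of `x` to that of `y` (any embedding of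
ordered site sets). [cite: ArakiMoriya2003, §4.1] -/
theorem fermionEmbed_cAt_of_apply_eq {Λ : Finset (Site d)} {Λ' : Finset (Site d')}
    (φ : PolySite Λ ↪ PolySite Λ') {x : Site d} (hx : x ∈ Λ) {y : Site d'} (hy : y ∈ Λ')
    (h : φ (PolySite.pt x hx) = PolySite.pt y hy) (σ : Fin 2) :
    fermionEmbed φ (cAt x hx σ) = cAt y hy σ := by
  rw [cAt, fermionEmbed_annihilation, h]

/-! ### §2. The pulled-back state `ω ∘ Γ_f` -/

namespace InfVolFermionState

/-- **The pullback `ω ∘ Γ_f` of an infinite-volume state along an injective site map** `f`: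
`(mapAct f hf ω)_Λ(A) = ω_{f(Λ)}(Γ(mapEmb f Λ) A)` — the state of the lattice fermions on `ℤ^d` obtained
by reading `ω` on the sublattice `f(ℤ^d) ⊆ ℤ^{d'}` (normalisation, positivity and compatibility with
isotony from the algebra-morphism properties and functoriality of `Γ`, exactly as for `shift` and
`d4Act`). Bratteli–Robinson I §4.3.1. [cite: BratteliRobinsonI1987, §4.3.1] -/
def mapAct (f : Site d → Site d') (hf : Function.Injective f) (ω : InfVolFermionState d') :
    InfVolFermionState d where
  expect Λ := ω.expect (mapSet f Λ) ∘ₗ (fermionEmbed (PolySite.mapEmb f hf Λ)).toLinearMap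
  expect_one Λ := by
    rw [LinearMap.comp_apply, AlgHom.toLinearMap_apply, map_one, ω.expect_one]
  expect_nonneg Λ A := by
    rw [LinearMap.comp_apply, AlgHom.toLinearMap_apply, fermionEmbed_conjTranspose_mul_self]
    exact ω.expect_nonneg _ _
  compatible Λ Λ' h A := by
    have h' : mapSet f Λ ⊆ mapSet f Λ' := mapSet_mono f h
    rw [LinearMap.comp_apply, AlgHom.toLinearMap_apply, LinearMap.comp_apply,
      AlgHom.toLinearMap_apply, fermionEmbed_fermionEmbed, ← ω.compatible h', fermionEmbed_fermionEmbed,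
      fermionEmbed_congr (φ := (PolySite.incl h).trans (PolySite.mapEmb f hf Λ'))
        (ψ := (PolySite.mapEmb f hf Λ).trans (PolySite.incl h')) (fun y => rfl)]

/-- The local expectations of the pulled-back state (definitional unfolding).
[cite: BratteliRobinsonI1987, §4.3.1] -/
theorem mapAct_expect (f : Site d → Site d') (hf : Function.Injective f) (ω : InfVolFermionState d')
    (Λ : Finset (Site d)) (A : FermionOp Λ) :
    (ω.mapAct f hf).expect Λ A = ω.expect (mapSet f Λ) (fermionEmbed (PolySite.mapEmb f hf Λ) A) :=
  rfl

/-! ### §3. Additive maps: translation invariance and density transfer -/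

/-- **Translation invariance transfers along an additive injective map**: if `ω` is translation
invariant then so is `ω ∘ Γ_f` (`τ_v` upstairs is `τ_{f(v)}` downstairs: `f(x + v) = f(x) + f(v)`).
[cite: BratteliRobinsonI1987, §4.3.1 (G-invariant states)] -/
theorem IsTranslationInvariant.mapAct {ω : InfVolFermionState d'} (hω : ω.IsTranslationInvariant)
    (f : Site d →+ Site d') (hf : Function.Injective f) : (ω.mapAct f hf).IsTranslationInvariant := by
  intro v
  refine InfVolFermionState.ext fun Λ => LinearMap.ext fun A => ?_
  rw [shift_expect, mapAct_expect, mapAct_expect, fermionEmbed_fermionEmbed]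
  conv_rhs => rw [← hω (f v), shift_expect, fermionEmbed_fermionEmbed]
  -- both sides live in regions contained in `f(Λ) + f(v)`; compare there
  have hsub : mapSet f (shiftSet v Λ) ⊆ shiftSet (f v) (mapSet f Λ) := by
    intro y hy
    obtain ⟨x, hx, rfl⟩ := (mem_mapSet_iff f).1 hy
    have hx' : x - v ∈ Λ := mem_shiftSet.1 hx
    exact mem_shiftSet.2 ((mem_mapSet_iff f).2 ⟨x - v, hx', map_sub f x v⟩)
  rw [← ω.compatible hsub, fermionEmbed_fermionEmbed,
    fermionEmbed_congr
      (φ := ((PolySite.shiftEmb v Λ).trans (PolySite.mapEmb f hf (shiftSet v Λ))).trans (PolySite.incl hsub))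
      (ψ := (PolySite.mapEmb f hf Λ).trans (PolySite.shiftEmb (f v) (mapSet f Λ)))
      (fun y => Subtype.ext (by
        simp only [Function.Embedding.trans_apply, PolySite.coe_incl, PolySite.coe_mapEmb_eq,
          PolySite.coe_shiftEmb, ofLex_toLex, map_add]))]

/-- **The density is preserved** when `f 0 = 0` (e.g. `f` additive): `ρ(ω ∘ Γ_f) = ρ(ω)`
(`Γ_f n_{0σ} = n_{f(0),σ} = n_{0σ}`). [cite: ArakiMoriya2003, §4.1] -/
theorem density_mapAct (ω : InfVolFermionState d') (f : Site d → Site d') (hf : Function.Injective f)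
    (h0 : f 0 = 0) : (ω.mapAct f hf).density = ω.density := by
  have hmem : (0 : Site d') ∈ mapSet f ({0} : Finset (Site d)) := by
    rw [← h0]; exact mem_mapSet_of_mem f (mem_singleton_self 0)
  have hsub : ({0} : Finset (Site d')) ⊆ mapSet f ({0} : Finset (Site d)) := singleton_subset_iff.2 hmem
  have hpt : PolySite.mapEmb f hf ({0} : Finset (Site d)) (PolySite.pt 0 (mem_singleton_self 0)) =
      PolySite.incl hsub (PolySite.pt 0 (mem_singleton_self 0)) :=
    by rw [PolySite.mapEmb_pt, PolySite.incl_pt]; exact PolySite.pt_congr _ _ h0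
  have hn : ∀ σ : Fin 2, fermionEmbed (PolySite.mapEmb f hf ({0} : Finset (Site d)))
      (nAt (0 : Site d) (mem_singleton_self 0) σ) =
        fermionEmbed (PolySite.incl hsub) (nAt (0 : Site d') (mem_singleton_self 0) σ) := by
    intro σ
    rw [nAt, nAt, fermionEmbed_numberOp, fermionEmbed_numberOp, hpt]
  rw [density, densityAt, density, densityAt, mapAct_expect, map_add, hn 0, hn 1, ← map_add,
    ω.compatible hsub]

end InfVolFermionState

/-! ### §4. The doubling map -/

/-- **The doubling map** `x ↦ 2x = x + x` of `ℤ^d` (additive, injective): it carries the unit steps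
`e_i` onto the axial range-2 steps `2e_i`. [cite: PavariniEtAl2001, eq. (1)] -/
def doubling (d : ℕ) : Site d →+ Site d := AddMonoidHom.id (Site d) + AddMonoidHom.id (Site d)

/-- `doubling x = x + x`. [cite: PavariniEtAl2001, eq. (1)] -/
@[simp] theorem doubling_apply (x : Site d) : doubling d x = x + x := rfl

/-- The doubling map is injective (`ℤ^d` has no `2`-torsion). [cite: PavariniEtAl2001, eq. (1)] -/
theorem doubling_injective : Function.Injective (doubling d) := by
  intro x y h
  rw [doubling_apply, doubling_apply] at h
  funext i
  have hi := congrFun h i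
  simp only [Pi.add_apply] at hi
  omega

/-- `2 e_i` is the axial range-2 step. [cite: PavariniEtAl2001, eq. (1)] -/
theorem doubling_unitVec (i : Fin d) : doubling d (unitVec i) = axial2Vec i := by
  rw [doubling_apply, axial2Vec_eq_unitVec_add_unitVec]

/-- Membership in `thicken {0} R` is the coordinatewise bound `|x_i| ≤ ⌊R⌋`. [cite: FriedliVelenik2017, §3.2] -/
theorem mem_thicken_zero_iff (R : ℝ) (x : Site d) :
    x ∈ thicken ({0} : Finset (Site d)) R ↔ ∀ i, -((⌊R⌋₊ : ℕ) : ℤ) ≤ x i ∧ x i ≤ (⌊R⌋₊ : ℕ) := by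
  rw [thicken, Finset.singleton_biUnion, Finset.mem_image]
  constructor
  · rintro ⟨v, hv, rfl⟩
    rw [zero_add]
    exact mem_box.1 hv
  · intro h
    exact ⟨x, mem_box.2 h, zero_add x⟩

/-- The doubling map carries `[-1,1]^d` into `[-2,2]^d`. [cite: FriedliVelenik2017, §3.2] -/
theorem mapSet_doubling_thicken_one_subset :
    mapSet (doubling d) (thicken ({0} : Finset (Site d)) 1) ⊆ thicken ({0} : Finset (Site d)) 2 := by
  intro y hy
  obtain ⟨x, hx, rfl⟩ := (mem_mapSet_iff _).1 hy
  rw [mem_thicken_zero_iff, Nat.floor_one] at hx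
  rw [mem_thicken_zero_iff, Nat.floor_ofNat]
  intro i
  have h := hx i
  rw [doubling_apply, Pi.add_apply]
  push_cast at h ⊢
  omega

/-! ### §5. The bond identity: `Γ_{2·}` carries `E_{Φ(1,0,0)}` onto `E_{Φ''(1)}` -/

section Bond

/-- **A nearest-neighbour bond term is carried onto an axial range-2 bond term** by every ordered-site
embedding that sends `x ↦ y`, `x + e_i ↦ y + 2e_i` (same amplitude; both are
`−t Σ_σ (c†c + h.c.)` on the two sites). [cite: PavariniEtAl2001, eq. (1)] -/
theorem fermionEmbed_hubbard_pair_eq_axial_pair (t U : ℝ) {Λ' : Finset (Site d)} (x : Site d) (i : Fin d)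
    (φ : PolySite ({x, x + unitVec i} : Finset (Site d)) ↪ PolySite Λ') (y : Site d)
    (ψ : PolySite ({y, y + axial2Vec i} : Finset (Site d)) ↪ PolySite Λ')
    (hx : ofLex (φ (PolySite.pt x (mem_insert_self _ _))).1 = ofLex (ψ (PolySite.pt y (mem_insert_self _ _))).1)
    (hxi : ofLex (φ (PolySite.pt (x + unitVec i) (mem_insert_of_mem (mem_singleton_self _)))).1 =
      ofLex (ψ (PolySite.pt (y + axial2Vec i) (mem_insert_of_mem (mem_singleton_self _)))).1) :
    fermionEmbed φ ((hubbardFermionInteraction d t U).Φ {x, x + unitVec i}) =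
      fermionEmbed ψ ((axialRange2HoppingFermionInteraction d t).Φ {y, y + axial2Vec i}) := by
  replace hx : φ (PolySite.pt x (mem_insert_self _ _)) = ψ (PolySite.pt y (mem_insert_self _ _)) :=
    Subtype.ext (by rw [← toLex_ofLex (φ _).1, hx, toLex_ofLex])
  replace hxi : φ (PolySite.pt (x + unitVec i) (mem_insert_of_mem (mem_singleton_self _))) =
      ψ (PolySite.pt (y + axial2Vec i) (mem_insert_of_mem (mem_singleton_self _))) :=
    Subtype.ext (by rw [← toLex_ofLex (φ _).1, hxi, toLex_ofLex])
  rw [hubbardFermionInteraction_apply_pair, axialRange2HoppingFermionInteraction_apply_pair, map_smul,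
    map_smul, map_sum, map_sum]
  refine congrArg _ (Finset.sum_congr rfl fun σ _ => ?_)
  rw [map_add, map_add, map_mul, map_mul, map_mul, map_mul, fermionEmbed_conjTranspose,
    fermionEmbed_conjTranspose, fermionEmbed_conjTranspose, fermionEmbed_conjTranspose,
    fermionEmbed_cAt_of_apply_eq φ _ (PolySite.ofLex_mem _) (by rw [hx, PolySite.pt_ofLex]) σ,
    fermionEmbed_cAt_of_apply_eq φ _ (PolySite.ofLex_mem _) (by rw [hxi, PolySite.pt_ofLex]) σ,
    fermionEmbed_cAt_of_apply_eq ψ _ (PolySite.ofLex_mem _) (PolySite.pt_ofLex _).symm σ,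
    fermionEmbed_cAt_of_apply_eq ψ _ (PolySite.ofLex_mem _) (PolySite.pt_ofLex _).symm σ]

/-- The unit nearest-neighbour interaction `Φ(1,0,0)` on `ℤ²`: its mean-energy observable at range `1`
is the sum of the four half nearest-neighbour bonds through the origin (the on-site `U = 0` term and
the `t' = 0` diagonal part vanish). [cite: XuEtAl2024, eq. (1)] -/
theorem meanEnergyObs_hubbardTTPrime_one_zero_zero :
    (hubbardTTPrimeFermionInteraction 1 0 0).meanEnergyObs 1 =
      ∑ i : Fin 2,
        ((2 : ℂ)⁻¹ • fermionEmbed (PolySite.incl (pair_unitVec_subset_thicken_one i))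
            ((hubbardFermionInteraction 2 1 0).Φ {0, 0 + unitVec i}) +
          (2 : ℂ)⁻¹ • fermionEmbed (PolySite.incl (pair_neg_unitVec_subset_thicken_one i))
            ((hubbardFermionInteraction 2 1 0).Φ {-unitVec i, -unitVec i + unitVec i})) := by
  have hdiag : (diagHoppingFermionInteraction 0).meanEnergyObs 1 = 0 := by
    have h : ∀ X, (diagHoppingFermionInteraction 0).Φ X = (0 : ℂ) • (diagHoppingFermionInteraction 1).Φ X := by
      intro X
      have h1 := diagHoppingFermionInteraction_smul 0 1 X
      rwa [zero_mul, Complex.ofReal_zero] at h1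
    rw [FermionInteraction.meanEnergyObs_of_smul h, zero_smul]
  rw [hubbardTTPrimeFermionInteraction_meanEnergyObs, hdiag, add_zero, hubbardFermionInteraction_meanEnergyObs,
    hubbardFermionInteraction_apply_singleton, Complex.ofReal_zero, zero_smul, map_zero, zero_add]

/-- **THE BOND IDENTITY.** The doubling map carries the mean-energy observable of the unit
nearest-neighbour hopping (range `1`) onto that of the unit third-neighbour hopping (range `2`):
`Γ_{[−2,2]² ⊇ 2·[−1,1]²} (Γ(mapEmb (2·)) E_{Φ(1,0,0)}) = E_{Φ''(1)}`. [cite: PavariniEtAl2001, eq. (1)] -/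
theorem fermionEmbed_mapEmb_meanEnergyObs_nnHop :
    fermionEmbed (PolySite.incl (mapSet_doubling_thicken_one_subset (d := 2)))
        (fermionEmbed (PolySite.mapEmb (doubling 2) doubling_injective (thicken ({0} : Finset (Site 2)) 1))
          ((hubbardTTPrimeFermionInteraction 1 0 0).meanEnergyObs 1)) =
      (axialRange2HoppingFermionInteraction 2 1).meanEnergyObs 2 := by
  rw [meanEnergyObs_hubbardTTPrime_one_zero_zero, axialRange2HoppingFermionInteraction_meanEnergyObs,
    map_sum, map_sum]
  refine Finset.sum_congr rfl fun i _ => ?_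
  rw [map_add, map_add, map_smul, map_smul, map_smul, map_smul, fermionEmbed_fermionEmbed,
    fermionEmbed_fermionEmbed, fermionEmbed_fermionEmbed, fermionEmbed_fermionEmbed]
  refine congrArg₂ (· + ·) (congrArg _ ?_) (congrArg _ ?_)
  · refine fermionEmbed_hubbard_pair_eq_axial_pair 1 0 0 i _ 0 _ ?_ ?_
    · simp only [Function.Embedding.trans_apply, PolySite.incl_pt, PolySite.mapEmb_pt,
        PolySite.ofLex_coe_pt, doubling_apply, add_zero]
    · simp only [Function.Embedding.trans_apply, PolySite.incl_pt, PolySite.mapEmb_pt,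
        PolySite.ofLex_coe_pt, doubling_apply, zero_add, axial2Vec_eq_unitVec_add_unitVec]
  · refine fermionEmbed_hubbard_pair_eq_axial_pair 1 0 (-unitVec i) i _ (-axial2Vec i) _ ?_ ?_
    · simp only [Function.Embedding.trans_apply, PolySite.incl_pt, PolySite.mapEmb_pt,
        PolySite.ofLex_coe_pt, doubling_apply, axial2Vec_eq_unitVec_add_unitVec, neg_add]
    · simp only [Function.Embedding.trans_apply, PolySite.incl_pt, PolySite.mapEmb_pt,
        PolySite.ofLex_coe_pt, doubling_apply, neg_add_cancel, add_zero]

/-- **`K₁(ω ∘ Γ_{2·}) = K₃(ω)`**: the unit nearest-neighbour hopping energy per site of the pulled-back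
state is the unit third-neighbour hopping energy per site of `ω`. [cite: PavariniEtAl2001, eq. (1)] -/
theorem InfVolFermionState.meanEnergy_nnHop_mapAct_doubling (ω : InfVolFermionState 2) :
    (ω.mapAct (doubling 2) doubling_injective).meanEnergy (hubbardTTPrimeFermionInteraction 1 0 0) 1 =
      ω.meanEnergy (axialRange2HoppingFermionInteraction 2 1) 2 := by
  rw [InfVolFermionState.meanEnergy, InfVolFermionState.meanEnergy, InfVolFermionState.mapAct_expect,
    ← ω.compatible mapSet_doubling_thicken_one_subset, fermionEmbed_mapEmb_meanEnergyObs_nnHop]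

end Bond

/-! ### §6. The kinematic `K₃` row for every translation-invariant state -/

namespace InfVolFermionState

/-- **`|K₃(ω)| ≤ 16/π²` for EVERY translation-invariant state of filling `0 < ρ < 2`**: the third-neighbour
bond density `K₃(ω) = e_{Φ''(1)}(ω)` equals `K₁(ω ∘ Γ_{2·})`, and `ω ∘ Γ_{2·}` is translation invariant of
the same filling, so the class-wide `K₁` row applies. [cite: LiebLoss1993, §8, Theorem 8.2] -/
theorem IsTranslationInvariant.abs_meanEnergy_axialRange2Hopping_le {ω : InfVolFermionState 2}
    (hω : ω.IsTranslationInvariant) (hρ0 : 0 < ω.density) (hρ2 : ω.density < 2) :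
    |ω.meanEnergy (axialRange2HoppingFermionInteraction 2 1) 2| ≤ 16 / Real.pi ^ 2 := by
  rw [← ω.meanEnergy_nnHop_mapAct_doubling]
  have hTI := hω.mapAct (doubling 2) doubling_injective
  have hρ := ω.density_mapAct (doubling 2) doubling_injective (map_zero _)
  exact hTI.abs_meanEnergy_nnHop_le (by rw [hρ]; exact hρ0) (by rw [hρ]; exact hρ2)

/-- **The kinematic `K₃` bracket of the filling class** (the `hB` slot of the `t''`-transport
theorems): `K₃(σ) ∈ [−16/π², 16/π²]` for every translation-invariant `σ` of filling `ρ ∈ (0,2)`.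
[cite: LiebLoss1993, §8, Theorem 8.2] -/
theorem IsTranslationInvariant.meanEnergy_axialRange2Hopping_mem_Icc {ω : InfVolFermionState 2}
    (hω : ω.IsTranslationInvariant) {ρ : ℝ} (hρ : ω.density = ρ) (hρ0 : 0 < ρ) (hρ2 : ρ < 2) :
    ω.meanEnergy (axialRange2HoppingFermionInteraction 2 1) 2 ∈
      Set.Icc (-(16 / Real.pi ^ 2)) (16 / Real.pi ^ 2) := by
  subst hρ
  exact abs_le.1 (hω.abs_meanEnergy_axialRange2Hopping_le hρ0 hρ2)

end InfVolFermionState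

/-! ### §7. `t''`-transport of the certified `t–t'` density at the kinematic constant -/

section TPPKinematic

/-- `min(s·(−c), s·c) = −c|s|` and `max(s·(−c), s·c) = c|s|` bookkeeping: `min (t''·(−K)) (t''·K) ≥ −K|t''|`.
[folklore] -/
private theorem neg_mul_abs_le_min (K s : ℝ) (hK : 0 ≤ K) : -(K * |s|) ≤ min (s * -K) (s * K) := by
  rcases le_total 0 s with hs | hs
  · rw [abs_of_nonneg hs]; refine le_min ?_ ?_ <;> nlinarith
  · rw [abs_of_nonpos hs]; refine le_min ?_ ?_ <;> nlinarith

/-- `max (t''·(−K)) (t''·K) ≤ K|t''|`. [folklore] -/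
private theorem max_le_mul_abs (K s : ℝ) (hK : 0 ≤ K) : max (s * -K) (s * K) ≤ K * |s| := by
  rcases le_total 0 s with hs | hs
  · rw [abs_of_nonneg hs]; refine max_le ?_ ?_ <;> nlinarith
  · rw [abs_of_nonpos hs]; refine max_le ?_ ?_ <;> nlinarith

/-- **KINEMATIC FLOOR in `t''` at fixed filling**: for `U ≥ 0`, `0 < ρ < 2` and every `t''`,
`energyDensityTT' t t' U ρ − (16/π²)|t''| ≤ e_ρ(t,t',t'',U)`. [cite: LiebLoss1993, §8, Theorem 8.2] -/
theorem energyDensityTT'_sub_kinematic_le_tpp (t t' : ℝ) {U : ℝ} (hU : 0 ≤ U) {ρ : ℝ} (hρ0 : 0 < ρ)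
    (hρ2 : ρ < 2) (t'' : ℝ) :
    energyDensityTT' t t' U ρ - 16 / Real.pi ^ 2 * |t''| ≤
      (hubbardTT'T''FermionInteraction t t' t'' U).tiGroundEnergyDensityAt 2 ρ := by
  have h := energyDensityTT'_floor_add_min_le_tpp t t' hU hρ0 hρ2 le_rfl
    (fun σ hσ hσρ => hσ.meanEnergy_axialRange2Hopping_mem_Icc hσρ hρ0 hρ2) t''
  have hm := neg_mul_abs_le_min (16 / Real.pi ^ 2) t'' (by positivity)
  linarith

/-- **KINEMATIC CAP in `t''` at fixed filling**: for `U ≥ 0`, `0 < ρ < 2` and every `t''`,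
`e_ρ(t,t',t'',U) ≤ energyDensityTT' t t' U ρ + (16/π²)|t''|` (the anchor state is a torus-limit `t–t'`
ground state, which carries `energyDensityTT'` exactly). [cite: LiebLoss1993, §8, Theorem 8.2] -/
theorem tpp_le_energyDensityTT'_add_kinematic (t t' : ℝ) {U : ℝ} (hU : 0 ≤ U) {ρ : ℝ} (hρ0 : 0 < ρ)
    (hρ2 : ρ < 2) (t'' : ℝ) :
    (hubbardTT'T''FermionInteraction t t' t'' U).tiGroundEnergyDensityAt 2 ρ ≤
      energyDensityTT' t t' U ρ + 16 / Real.pi ^ 2 * |t''| := by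
  obtain ⟨ψ, φ, ω, -, -, -, -, hTI, -, hdens, he⟩ :=
    exists_isTorusLimitOf_meanEnergy_hubbardTTPrime_eq t t' hU hρ0.le hρ2 tendsto_id
  have h := tpp_le_cap_add_max_of_one t t' U hTI hdens he.le
    (hTI.meanEnergy_axialRange2Hopping_mem_Icc hdens hρ0 hρ2) t''
  have hm := max_le_mul_abs (16 / Real.pi ^ 2) t'' (by positivity)
  linarith

/-- **`t''`-TRANSPORT AT THE KINEMATIC CONSTANT.** For `U ≥ 0`, `0 < ρ < 2` and every `t''`:
`|e_ρ(t,t',t'',U) − energyDensityTT' t t' U ρ| ≤ (16/π²)|t''|` — every certified `t–t'` window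
`[lo, hi]` at filling `ρ` is an object-M window `[lo − (16/π²)|t''|, hi + (16/π²)|t''|]` for the
translation-invariant fixed-filling density of the `t–t'–t''` model (`16/π² < 1.6212`).
[cite: LiebLoss1993, §8, Theorem 8.2] -/
theorem abs_tiGroundEnergyDensityAt_tpp_sub_energyDensityTT'_le_kinematic (t t' : ℝ) {U : ℝ} (hU : 0 ≤ U)
    {ρ : ℝ} (hρ0 : 0 < ρ) (hρ2 : ρ < 2) (t'' : ℝ) :
    |(hubbardTT'T''FermionInteraction t t' t'' U).tiGroundEnergyDensityAt 2 ρ - energyDensityTT' t t' U ρ| ≤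
      16 / Real.pi ^ 2 * |t''| := by
  rw [abs_sub_le_iff]
  constructor
  · linarith [tpp_le_energyDensityTT'_add_kinematic t t' hU hρ0 hρ2 t'']
  · linarith [energyDensityTT'_sub_kinematic_le_tpp t t' hU hρ0 hρ2 t'']

/-- **Certified `t–t'` window ⇒ object-M window at the kinematic constant**: `lo ≤ e(t,t',U,ρ) ≤ hi`
gives `lo − (16/π²)|t''| ≤ e_ρ(t,t',t'',U) ≤ hi + (16/π²)|t''|`. [cite: LiebLoss1993, §8, Theorem 8.2] -/
theorem tiGroundEnergyDensityAt_tpp_mem_Icc_kinematic (t t' : ℝ) {U : ℝ} (hU : 0 ≤ U) {ρ : ℝ}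
    (hρ0 : 0 < ρ) (hρ2 : ρ < 2) {lo hi : ℝ} (hlo : lo ≤ energyDensityTT' t t' U ρ)
    (hhi : energyDensityTT' t t' U ρ ≤ hi) (t'' : ℝ) :
    (hubbardTT'T''FermionInteraction t t' t'' U).tiGroundEnergyDensityAt 2 ρ ∈
      Set.Icc (lo - 16 / Real.pi ^ 2 * |t''|) (hi + 16 / Real.pi ^ 2 * |t''|) := by
  constructor
  · linarith [energyDensityTT'_sub_kinematic_le_tpp t t' hU hρ0 hρ2 t'']
  · linarith [tpp_le_energyDensityTT'_add_kinematic t t' hU hρ0 hρ2 t'']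

end TPPKinematic

end Literature.MathematicalPhysics.QuantumLattice

end
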